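import Summits.QuantumAdvantage.QuantumAdvantage.Theorems.CharDialTokenDialK
import Summits.QuantumAdvantage.QuantumAdvantage.Theorems.CharDialTokenDialI
import HarnessLib

/-!
# CharDial tower — the TOKEN DIAL, part L: the nine-dial split of `T` BY NAME, and `fieldY ∈ class(RESIDUAL-HIGH⁹(K, w))`

Cell `decomp-qadv`, lens 6 («barrier-complement carving»), generation 19 (REV3); supports stmt-QuantumAdvantage-27206 / 27207
(crux 32604).  Imports part K (the flip dial and the nine-dial pieces) and part I (the eight-dial junction by name, `fieldY` escape).

(1) ★★ `closes_split9 K w : LowResidual9Side dialB K w → ResidualHigh9Side dialB K w → Theses.CharDial.WalkHardFJLinOdd`, its converse,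
`T ⟺ LOW-RESIDUAL⁹ ∧ RESIDUAL-HIGH⁹`, `T ⟺ Residual9Side K w`, and the filed items by name:
`JLinLowResidual5 (27206) ⟺ LowResidual9Side dialB K w`, `JLinResidualHigh5 (27207) ⟺ ResidualHigh9Side dialB K w` — every `K`, `w`.
(2) ★★★ the Frobenius column family `fieldY` escapes the flip dial too (`field_not_flip`: more than `K` of its cuts move at every
adjacency — the same witness as `field_not_tokenSem`), so class(RESIDUAL-HIGH⁹(K, w)) is INHABITED for every prime `p ≥ 5`, every `K`
and every `w`, and a purported RESIDUAL-HIGH⁹ bound is tested non-vacuously.  0 sorry.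
-/

set_option autoImplicit false

open Finset

namespace Summit.QuantumAdvantage.AdviceFreeQNC0.JLinPeel.TokenDial

open SegMove

variable {n : ℕ}

/-! ### (1) the nine-dial split of T, by name, every `K`, `w` -/

/-- ★★ **the DECIDING THEOREM of the nine-dial split** (item vocabulary, every `K`, `w`): LOW-RESIDUAL⁹ ∧ RESIDUAL-HIGH⁹ at schedule
`dialB` close `T`. -/
theorem closes_split9 (K w : ℕ) (hL : TowerDefs.LowResidual9Side TowerDefs.dialB K w)
    (hH : TowerDefs.ResidualHigh9Side TowerDefs.dialB K w) :
    Summit.QuantumAdvantage.QuantumAdvantage.Theses.CharDial.WalkHardFJLinOdd :=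
  closes_split6 ((lowResidual6_iff_lowResidual9 TowerDefs.dialB K w).2 hL)
    ((residualHigh6_iff_residualHigh9 TowerDefs.dialB K w).2 hH)

/-- ★★ conversely `T` gives both nine-dial pieces, every `K`, `w`. -/
theorem split9_of_closes (K w : ℕ) (hT : Summit.QuantumAdvantage.QuantumAdvantage.Theses.CharDial.WalkHardFJLinOdd) :
    TowerDefs.LowResidual9Side TowerDefs.dialB K w ∧ TowerDefs.ResidualHigh9Side TowerDefs.dialB K w :=
  let ⟨hL, hH⟩ := split6_of_closes hT
  ⟨(lowResidual6_iff_lowResidual9 TowerDefs.dialB K w).1 hL, (residualHigh6_iff_residualHigh9 TowerDefs.dialB K w).1 hH⟩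

/-- ★★ `T ⟺ LOW-RESIDUAL⁹(dialB, K, w) ∧ RESIDUAL-HIGH⁹(dialB, K, w)`, every `K`, `w`. -/
theorem walkHardFJLinOdd_iff_residual9_split (K w : ℕ) :
    Summit.QuantumAdvantage.QuantumAdvantage.Theses.CharDial.WalkHardFJLinOdd ↔
      (TowerDefs.LowResidual9Side TowerDefs.dialB K w ∧ TowerDefs.ResidualHigh9Side TowerDefs.dialB K w) :=
  ⟨split9_of_closes K w, fun h => closes_split9 K w h.1 h.2⟩

/-- ★★ `T ⟺ RESIDUAL⁹(K, w)` (all nine dials absorbed, no variation split), every `K`, `w`. -/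
theorem walkHardFJLinOdd_iff_residual9 (K w : ℕ) :
    Summit.QuantumAdvantage.QuantumAdvantage.Theses.CharDial.WalkHardFJLinOdd ↔ TowerDefs.Residual9Side K w :=
  (walkHardFJLinOdd_iff_residual8 K).trans (residual8_iff_residual9 K w)

/-- ★ the filed LOW piece (item 27206) ⟺ LOW-RESIDUAL⁹(dialB, K, w), by name, every `K`, `w`. -/
theorem jlinLowResidual5_iff_lowResidual9 (K w : ℕ) :
    Summit.QuantumAdvantage.QuantumAdvantage.Theses.CharDial.JLinLowResidual5 ↔
      TowerDefs.LowResidual9Side TowerDefs.dialB K w :=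
  (jlinLowResidual5_iff_lowResidual8 K).trans (lowResidual8_iff_lowResidual9 TowerDefs.dialB K w)

/-- ★ the filed HIGH residual (item 27207) ⟺ RESIDUAL-HIGH⁹(dialB, K, w), by name, every `K`, `w`. -/
theorem jlinResidualHigh5_iff_residualHigh9 (K w : ℕ) :
    Summit.QuantumAdvantage.QuantumAdvantage.Theses.CharDial.JLinResidualHigh5 ↔
      TowerDefs.ResidualHigh9Side TowerDefs.dialB K w :=
  (jlinResidualHigh5_iff_residualHigh8 K).trans (residualHigh8_iff_residualHigh9 TowerDefs.dialB K w)

/-! ### (2) the RESIDUAL-HIGH⁹ class is inhabited: more than `K` cuts of `fieldY` move at every adjacency -/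

section Escape

variable {p : ℕ} [hp : Fact p.Prime]

/-- **`fieldY` escapes the flip dial with `K` readers** (any window `w`) whenever `K + 1` full-pattern cuts per column fit: at an
adjacent pair some column `r` jumps, and the `K+1` cuts `cutAt r k c₀` are NOT swap-stable (they flip on the transposed indicator
input of `s`), so no set of `≤ K` cuts leaves the rest swap-stable.  A statement about the strategy `fieldY` alone. -/
theorem field_not_flip (n K w Kb : ℕ) (hbig : p * (NullDial.sepM p n + (FieldCol.rk n + 1) * (Kb + 2)) ≤ n + 1)
    (hK : K + 1 ≤ Kb) (α : GaloisField p (FieldCol.rk n)) (h0 : α ≠ 0) (h1 : α ≠ 1) :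
    ¬ TowerDefs.FlipHyp p K w (FieldCol.fieldY p n α) := by
  classical
  haveI : NeZero p := ⟨hp.out.ne_zero⟩
  rintro ⟨s, t, hst, G, hGK, -, hS, -⟩
  obtain ⟨r, hr⟩ := FieldCol.exists_col_jump p n α h0 h1 s t hst
  have hts : t ≠ s := fun h => by rw [h] at hst; omega
  set u₀ : Fin n → Bool := fun i => decide (i = s) with hu₀
  have hne : u₀ s ≠ u₀ t := by rw [hu₀]; simp [hts]
  set c₀ : Fin p := ⟨(form (FieldCol.col p n α r) u₀).val, ZMod.val_lt _⟩ with hc₀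
  have hcu : ((c₀.val : ℕ) : ZMod p) = form (FieldCol.col p n α r) u₀ := ZMod.natCast_zmod_val _
  set f : Fin (K + 1) → Fin (n + 1) := fun k => FieldCol.cutAt p n Kb hbig r ⟨k.val, lt_of_lt_of_le k.isLt hK⟩ c₀ with hf0
  have hf : Function.Injective f := by
    intro k k' hkk
    have h := FieldCol.cutAt_injective p n Kb hbig r c₀ hkk
    exact Fin.ext (by simpa using congrArg Fin.val h)
  have hmem : ∀ k, f k ∈ G := by
    intro k
    by_contra hk
    exact FieldCol.fieldY_flip p n Kb hbig α r _ c₀ u₀ s t hst hne hr hcu (hS (f k) hk u₀ hne)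
  have h1c : (univ.image f).card = K + 1 := by rw [card_image_of_injective _ hf, card_univ, Fintype.card_fin]
  have h2c : univ.image f ⊆ G := fun g hg => by
    obtain ⟨k, -, rfl⟩ := mem_image.1 hg
    exact hmem k
  have h3c := card_le_card h2c
  omega

/-- ★★★ **`fieldY` in class(RESIDUAL-HIGH⁹(K, w)), eventually** (every prime `p ≥ 5`, every `K`, every `w`): JLin-presentable
(junta-free), HIGH at `dialB`, outside the semantic token dial with `K` readers, outside the flip dial with `K` readers within `w`, and in
EVERY `log₂ n`-junta presentation outside the rank, sparse, block, null and mask dials. -/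
theorem fieldY_class9_eventually (hp5 : 5 ≤ p) (K w : ℕ) : ∃ n₀ : ℕ, ∀ n ≥ n₀, ∃ α : GaloisField p (FieldCol.rk n),
    TowerDefs.JLinHyp p n (FieldCol.fieldY p n α) ∧ ¬ TowerDefs.LowVar TowerDefs.dialB n (FieldCol.fieldY p n α) ∧
    ¬ TowerDefs.TokenHypSem p K (FieldCol.fieldY p n α) ∧ ¬ TowerDefs.FlipHyp p K w (FieldCol.fieldY p n α) ∧
    ∀ D : JLinPeel.JLinData p n, D.strat = FieldCol.fieldY p n α → (∀ g, (D.J g).card ≤ Nat.log 2 n) →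
      ¬ TowerDefs.SpanHyp D ∧ ¬ TowerDefs.SparseHyp D ∧ ¬ TowerDefs.BlockHyp D ∧ ¬ TowerDefs.NullHyp D ∧
        ¬ TowerDefs.MaskHyp D := by
  have hp3 : p % 3 = 1 ∨ p % 3 = 2 := Tower.mod3_of_prime_ge5 hp.out hp5
  obtain ⟨n₁, hn₁⟩ := FieldCol.eventually_fits p
  obtain ⟨n₂, hn₂⟩ := FieldCol.eventually_big p
  obtain ⟨n₃, hn₃⟩ := FieldCol.eventually_misc p
  obtain ⟨n₄, hn₄⟩ := FieldCol.field_not_span_eventually p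
  refine ⟨max (max (max n₁ n₂) (max n₃ n₄)) (2 ^ K), fun n hn => ?_⟩
  have hn' : max (max n₁ n₂) (max n₃ n₄) ≤ n := le_trans (le_max_left _ _) hn
  have hK := readers_fit (n := n) K (le_trans (le_max_right _ _) hn)
  have hfit := hn₁ n (le_trans (le_trans (le_max_left _ _) (le_max_left _ _)) hn')
  have hbig := hn₂ n (le_trans (le_trans (le_max_right _ _) (le_max_left _ _)) hn')
  obtain ⟨hpL, hpn, hn9⟩ := hn₃ n (le_trans (le_trans (le_max_left _ _) (le_max_right _ _)) hn')
  have hspan := hn₄ n (le_trans (le_trans (le_max_right _ _) (le_max_right _ _)) hn')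
  obtain ⟨α, hα⟩ := FieldCol.exists_generic p n (by omega)
  have h0 : α ≠ 0 := FieldCol.generic_ne_zero p n (by omega) α hα
  have h1 : α ≠ 1 := FieldCol.generic_ne_one p n hpL hpn α hα
  have hL2 : 2 ≤ Nat.log 2 n := le_trans (by omega) hpL
  refine ⟨α, ?_, FieldCol.not_low_fieldY p n _ hbig le_rfl (by omega) α h0 h1,
    field_not_tokenSem n K _ hbig hK α h0 h1, field_not_flip n K w _ hbig hK α h0 h1, fun D hD hJ => ?_⟩
  · intro g
    exact ⟨∅, by simp, (FieldCol.fieldData p n α).a g, (FieldCol.fieldData p n α).h g, fun _ _ _ _ => rfl, fun u => rfl⟩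
  · have hM : ¬ TowerDefs.MaskHyp D := (Tower.maskHyp_iff_inlined D).not.mpr (FieldCol.field_not_mask p n hfit α hα D hD hJ)
    exact ⟨(Tower.spanHyp_iff_inlined D).not.mpr (hspan α D hD hJ),
      (Tower.sparseHyp_iff_inlined D).not.mpr (FieldCol.field_not_sparse p n hfit hL2 α D hD),
      fun hB => hM (Tower.maskHyp_of_blockHyp hp3 D hB), fun hN => hM (Tower.maskHyp_of_nullHyp D hN), hM⟩

/-- ★★★ **class(RESIDUAL-HIGH⁹(K, w)) IS INHABITED**, every `K`, `w` (item vocabulary): for every prime `p ≥ 5` and all large `n` some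
strategy satisfies the JLin hypothesis, is HIGH at schedule `dialB`, escapes the semantic token dial with `K` readers and the flip dial
with `K` readers within `w`, and escapes the five decided presentation-level dials in every `log₂ n`-junta ⊕ one-form presentation. -/
theorem residualHigh9_class_inhabited (p : ℕ) [Fact p.Prime] (hp5 : 5 ≤ p) (K w : ℕ) :
    ∃ n₁ : ℕ, ∀ n ≥ n₁, ∃ y : Fin (n + 1) → (Fin n → Bool) → Bool,
      TowerDefs.JLinHyp p n y ∧ ¬ TowerDefs.LowVar TowerDefs.dialB n y ∧ ¬ TowerDefs.TokenHypSem p K y ∧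
      ¬ TowerDefs.FlipHyp p K w y ∧
      ∀ D : JLinPeel.JLinData p n, D.strat = y → (∀ g, (D.J g).card ≤ Nat.log 2 n) →
        ¬ TowerDefs.SpanHyp D ∧ ¬ TowerDefs.SparseHyp D ∧ ¬ TowerDefs.BlockHyp D ∧ ¬ TowerDefs.NullHyp D ∧
          ¬ TowerDefs.MaskHyp D := by
  obtain ⟨n₀, h⟩ := fieldY_class9_eventually (p := p) hp5 K w
  exact ⟨n₀, fun n hn => let ⟨α, hy, hV, hS, hF, hesc⟩ := h n hn; ⟨FieldCol.fieldY p n α, hy, hV, hS, hF, hesc⟩⟩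

/-- ★ **RESIDUAL-HIGH⁹(K, w) is tested NON-VACUOUSLY**: a purported `ResidualHigh9Side dialB K w` bound applies to an actual member of
its class. -/
theorem residualHigh9_nonvacuous (K w : ℕ) (hR : TowerDefs.ResidualHigh9Side TowerDefs.dialB K w) (p : ℕ) [Fact p.Prime]
    (hp5 : 5 ≤ p) :
    ∃ θ : ℝ, θ < 1 ∧ ∃ n₀ : ℕ, ∀ n ≥ n₀, ∃ y : Fin (n + 1) → (Fin n → Bool) → Bool,
      TowerDefs.JLinHyp p n y ∧ ¬ TowerDefs.LowVar TowerDefs.dialB n y ∧ ∀ c : ℕ,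
        ((Finset.univ.filter fun u : Fin n → Bool => ringWinU c y u = true).card : ℝ) ≤ θ * (2 : ℝ) ^ n := by
  obtain ⟨θ, hθ, n₀, h⟩ := hR p hp5
  obtain ⟨n₁, h₁⟩ := residualHigh9_class_inhabited p hp5 K w
  refine ⟨θ, hθ, max n₀ n₁, fun n hn => ?_⟩
  obtain ⟨y, hy, hV, hS, hF, hesc⟩ := h₁ n (le_trans (le_max_right _ _) hn)
  exact ⟨y, hy, hV, fun c => h n (le_trans (le_max_left _ _) hn) c y hy hV hS hF hesc⟩

end Escape

end Summit.QuantumAdvantage.AdviceFreeQNC0.JLinPeel.TokenDial
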